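import Mathlib

/-!
# Route BarrierLever — Chow witnesses for partition minors (item 20172, CPM): determinant algebra of
# the STAR STEP WITH A GENERAL (non-tensor) GADGET — the exact `t`-free blow-down identity

Helper file (`--supports stmt-ValiantsHypothesis-20172`; cell valiant-natproofs, rung V4, 𝒟-side of
door (c); seat val-np-p4 gen 14).  Closes NO item; pure matrix algebra in the block (`Sum`) indexing
of `…ChowMultiEdgeStepDet` / `…ChowMultiTensorStepDet`.  This is the kernel form of the identity of
memo HOME/val-np-p4/g13/MEMO-blowdown-steps-g13.md §6 (there verified exactly by seat scripts), the
lead g13 left for the `(4,5)` residue of the CPM engine: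

> for STAR rows (base row `B`, special rows `B ∆ a_l`, `l < k`) and any `t`-free gadget `G` in the
> `k + k` blow-down variables, the partition matrix of «gadget × lifted common witness `F`» is
> `M i j = G[status_i, τ_j] · F[label_i, ω_j]`, and
> `det M = (∏_j G[s, τ_j]) · (± det Δ_G · ∏_e F[B∖A, ω_e]) · det(reduced)`,
> `Δ_G[l, e] = ρ_l(τ_e) − ρ_l(τ_{rep e})`, `ρ_l(τ) = G[s ∆ a_l, τ] / G[s, τ]`.

In block form: index type `Fin k ⊕ ρ` (special rows / excess columns `inl`, the rest `inr`, base row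
`inr b₀`, representative columns `inr (βc e)`); after dividing column `j` by `γ j = G[s, τ_j]` the
matrix is `N i j = w i j · F i j` with row weights `w (inl l) j = ρ_l(τ_j)` on the special rows and
`w (inr _) j = 1` elsewhere; special rows of `F` equal the base row, excess columns equal their
representatives.  Statements:

* `det_starWeighted_eq` — `det N = det (Δ · diagonal (F (inr b₀) (inr (βc e)))) · det (F.submatrix inr inr)`
  with `Δ l e = w l (inl e) − w l (inr (βc e))` (block column reduction, no parameter);
* `det_starGadget_ne_zero` — with column scalings `γ j ≠ 0`: if `det Δ ≠ 0`, the base-row entries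
  `F (inr b₀) (inr (βc e)) ≠ 0` and the reduced minor is nonsingular, then
  `det [γ j · w i j · F i j] ≠ 0`.

So a `k`-gadget certificate for a star core is: `det Δ_G ≠ 0` (a rational function of the gadget's
coefficient table on the finite column TYPE), nonvanishing of `G[s, τ]`, and the reduced layout — the
layout-level consumer (gadget as `k + k` explicit affine forms, `k`-fold coordinate lift, common
witness for the reduced layout and the `k` base entries) is left to the successor.

WHAT THIS IS NOT: a reduction step by itself; nothing on items 20172 / 20195 / 19717 themselves, on
crux stmt-ValiantsHypothesis-14610, or on `VP` versus `VNP`.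
-/

set_option linter.dupNamespace false

namespace Summit.ValiantsHypothesis.ValiantsHypothesis.Theorems.BarrierLever.ChowFactor

open Matrix

noncomputable section

variable {k : ℕ} {ρ : Type*} [Fintype ρ] [DecidableEq ρ]

/-- The row-weighted matrix of the star step: special rows `inl l` carry the weights `w l j`
(`= G[s ∆ a_l, τ_j] / G[s, τ_j]`), the other rows weight `1`. -/
def starWeighted (F : Matrix (Fin k ⊕ ρ) (Fin k ⊕ ρ) ℂ) (w : Fin k → Fin k ⊕ ρ → ℂ) :
    Matrix (Fin k ⊕ ρ) (Fin k ⊕ ρ) ℂ :=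
  Matrix.of fun i j => (Sum.elim (fun l => w l j) (fun _ => (1 : ℂ)) i) * F i j

omit [Fintype ρ] [DecidableEq ρ] in
/-- Entry formula for `starWeighted` on special rows. -/
theorem starWeighted_inl (F : Matrix (Fin k ⊕ ρ) (Fin k ⊕ ρ) ℂ) (w : Fin k → Fin k ⊕ ρ → ℂ)
    (l : Fin k) (j : Fin k ⊕ ρ) : starWeighted F w (Sum.inl l) j = w l j * F (Sum.inl l) j := by
  simp [starWeighted]

omit [Fintype ρ] [DecidableEq ρ] in
/-- Entry formula for `starWeighted` on the other rows. -/
theorem starWeighted_inr (F : Matrix (Fin k ⊕ ρ) (Fin k ⊕ ρ) ℂ) (w : Fin k → Fin k ⊕ ρ → ℂ)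
    (m : ρ) (j : Fin k ⊕ ρ) : starWeighted F w (Sum.inr m) j = F (Sum.inr m) j := by
  simp [starWeighted]

/-- **The `t`-free blow-down identity (block column reduction).**  If the special rows of `F` equal
the base row `inr b₀` and the excess columns equal their representatives `inr (βc e)`, then
`det (starWeighted F w) = det (Δ · diagonal (F (inr b₀) (inr (βc e)))) · det (F.submatrix inr inr)`,
`Δ l e = w l (inl e) − w l (inr (βc e))`. -/
theorem det_starWeighted_eq (F : Matrix (Fin k ⊕ ρ) (Fin k ⊕ ρ) ℂ) (w : Fin k → Fin k ⊕ ρ → ℂ)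
    (b₀ : ρ) (βc : Fin k → ρ) (hrow : ∀ l j, F (Sum.inl l) j = F (Sum.inr b₀) j)
    (hcol : ∀ i e, F i (Sum.inl e) = F i (Sum.inr (βc e))) :
    (starWeighted F w).det =
      ((Matrix.of fun l e : Fin k => w l (Sum.inl e) - w l (Sum.inr (βc e))) *
        Matrix.diagonal (fun e => F (Sum.inr b₀) (Sum.inr (βc e)))).det *
        (F.submatrix Sum.inr Sum.inr).det := by
  classical
  set H : Matrix (Fin k ⊕ ρ) (Fin k ⊕ ρ) ℂ :=
    Matrix.fromBlocks 1 0 (Matrix.of fun m e => if m = βc e then (-1 : ℂ) else 0) 1 with hH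
  have hHdet : H.det = 1 := by
    rw [hH, Matrix.det_fromBlocks_zero₁₂, Matrix.det_one, Matrix.det_one, mul_one]
  have hNH_inl : ∀ i e, (starWeighted F w * H) i (Sum.inl e) =
      starWeighted F w i (Sum.inl e) - starWeighted F w i (Sum.inr (βc e)) := by
    intro i e
    rw [Matrix.mul_apply, Fintype.sum_sum_type]
    simp [hH, Matrix.one_apply, mul_ite, Finset.sum_ite_eq', sub_eq_add_neg]
  have hNH_inr : ∀ i m, (starWeighted F w * H) i (Sum.inr m) = starWeighted F w i (Sum.inr m) := by
    intro i m
    rw [Matrix.mul_apply, Fintype.sum_sum_type]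
    simp [hH, Matrix.one_apply, mul_ite, Finset.sum_ite_eq']
  have key : starWeighted F w * H = Matrix.fromBlocks
      ((Matrix.of fun l e : Fin k => w l (Sum.inl e) - w l (Sum.inr (βc e))) *
        Matrix.diagonal (fun e => F (Sum.inr b₀) (Sum.inr (βc e))))
      (Matrix.of fun l m => w l (Sum.inr m) * F (Sum.inr b₀) (Sum.inr m))
      0 (F.submatrix Sum.inr Sum.inr) := by
    ext i j
    rcases i with l | m <;> rcases j with e | m'
    · rw [hNH_inl, Matrix.fromBlocks_apply₁₁, Matrix.mul_diagonal, starWeighted_inl, starWeighted_inl,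
        Matrix.of_apply, hrow, hrow, hcol]
      ring
    · rw [hNH_inr, Matrix.fromBlocks_apply₁₂, starWeighted_inl, Matrix.of_apply, hrow]
    · rw [hNH_inl, Matrix.fromBlocks_apply₂₁, Matrix.zero_apply, starWeighted_inr, starWeighted_inr,
        hcol, sub_self]
    · rw [hNH_inr, Matrix.fromBlocks_apply₂₂, Matrix.submatrix_apply, starWeighted_inr]
  have h1 := congrArg Matrix.det key
  rw [Matrix.det_mul, hHdet, mul_one, Matrix.det_fromBlocks_zero₂₁] at h1
  exact h1

/-- **The star step with a general gadget, determinant form.**  With nonzero column scalings `γ j`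
(`= G[s, τ_j]`), row weights `w` on the special rows, special rows of `F` equal to the base row and
excess columns equal to their representatives: if `det Δ ≠ 0`, the base-row entries at the
representatives are nonzero and the reduced minor is nonsingular, then
`det [γ j · (w-weighted F) i j] ≠ 0`. -/
theorem det_starGadget_ne_zero (F : Matrix (Fin k ⊕ ρ) (Fin k ⊕ ρ) ℂ) (w : Fin k → Fin k ⊕ ρ → ℂ)
    (γ : Fin k ⊕ ρ → ℂ) (b₀ : ρ) (βc : Fin k → ρ)
    (hrow : ∀ l j, F (Sum.inl l) j = F (Sum.inr b₀) j)
    (hcol : ∀ i e, F i (Sum.inl e) = F i (Sum.inr (βc e)))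
    (hγ : ∀ j, γ j ≠ 0)
    (hΔ : (Matrix.of fun l e : Fin k => w l (Sum.inl e) - w l (Sum.inr (βc e))).det ≠ 0)
    (hlab : ∀ e, F (Sum.inr b₀) (Sum.inr (βc e)) ≠ 0)
    (hred : (F.submatrix Sum.inr Sum.inr).det ≠ 0) :
    (Matrix.of fun i j => γ j * starWeighted F w i j).det ≠ 0 := by
  classical
  have hscale : (Matrix.of fun i j => γ j * starWeighted F w i j) =
      starWeighted F w * Matrix.diagonal γ := by
    ext i j
    rw [Matrix.mul_diagonal, Matrix.of_apply, mul_comm]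
  rw [hscale, Matrix.det_mul, Matrix.det_diagonal, det_starWeighted_eq F w b₀ βc hrow hcol,
    Matrix.det_mul, Matrix.det_diagonal]
  refine mul_ne_zero (mul_ne_zero (mul_ne_zero hΔ ?_) hred) ?_
  · exact Finset.prod_ne_zero_iff.mpr fun e _ => hlab e
  · exact Finset.prod_ne_zero_iff.mpr fun j _ => hγ j

end

end Summit.ValiantsHypothesis.ValiantsHypothesis.Theorems.BarrierLever.ChowFactor
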